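import Summits.SmoothPoincare4.SmoothPoincare4.Theorems.DcrGap.Negative.NoDiscNormalForm
import Summits.SmoothPoincare4.SmoothPoincare4.Theorems.DcrGap.Negative.KZeroIsFgmw
import Literature.Topology.FourManifolds.SmaleHomologySpheresFiveSixTheta

/-!
# `homology_ladder` — F3 WITNESS FILE (sorry-free): the floor rung `R = ℚ` of the ambient-homology ladder

Companion of `Lines/homology_ladder.lean` (same definitions, namespace `…HomologyLadder.Special`
so the two files never clash).  Contents, all WITHOUT `sorry`:

* the rung family `HomologySphereSliceGap R` and the top `SimplyConnectedSliceGap`;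
* ON-PATH `homologySphereSliceGap_int_of_dcrGap : DcrGap → HomologySphereSliceGap ℤ` and the
  recognition `dcrGap_of_simplyConnectedSliceGap : SimplyConnectedSliceGap → DcrGap`
  (`simplyConnectedSliceGap_of_dcrGap` the converse) — the top of the ladder IS the crux;
* the FLOOR named fact `rationalSliceGap_floor` (figure-eight knot: rationally slice
  [Kawauchi 2009; Kim–Wu 2018 Lemma 3.1 (2)], not slice [Fox–Milnor; Kim–Wu 2018 Rem. 1.4]) and the
  witness `homologySphereSliceGap_rat_of_floor : rationalSliceGap_floor → HomologySphereSliceGap ℚ`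
  — `example : Rung ℚ` from the floor fact, as the F3 contract asks.

Probes recorded in the seat's NOTES.md (`birth-certificate:`): `Rung ℤ → DcrGap`, `Rung ℤ → ¬SPC4`,
`floor → Rung ℤ`, `Rung ℚ → Rung ℤ`, `⊢ Rung ℤ`, `⊢ ¬Rung ℤ`, `SPC4 → ¬Rung ℤ` all FAIL under
`exact? | simpa | aesop`; `DcrGap → Rung ℤ` closes (`exact?` finds the on-path theorem);
`#h21_crux_probe` on `Rung ℤ`: VERDICT CLEAN against both the crux and the route's `closes`.
-/

noncomputable section

set_option linter.dupNamespace false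
set_option linter.style.longLine false

open scoped Manifold ContDiff Topology
open Function Set CategoryTheory Limits
open Literature.Topology.FourManifolds Literature.Topology.FourManifolds.MMSW
open Literature.AlgebraicTopology.SingularHomology Literature.AlgebraicTopology.Homotopy
open Summit.SmoothPoincare4.SmoothPoincare4.Theses.DottedCircleRasmussen
open Summit.SmoothPoincare4.SmoothPoincare4.Theorems.DcrGap

namespace Summit.SmoothPoincare4.SmoothPoincare4.Cruxes.DcrGap.HomologyLadder.Special

/-! ## The gradation parameter: the coefficient ring of the homology-sphere condition -/

/-- **`M` has the `R`-homology of the `n`-sphere** (`R` a commutative ring of coefficients):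
`Hᵢ(M; R) = 0` for `0 < i ≠ n` and `Hₙ(M; R) ≅ R`.  For `R = ℤ` this is the tree's
`IsHomologySphere M n` on the nose (`isHomologySphereOver_int_iff`). [cite: HatcherAT2002, Cor. 2.14] -/
def IsHomologySphereOver (R : Type) [CommRing R] (M : Type) [TopologicalSpace M] (n : ℕ) : Prop :=
  (∀ i : ℕ, 0 < i → i ≠ n → IsZero (singularHomology R R M i)) ∧
    Nonempty (singularHomology R R M n ≅ ModuleCat.of R (ULift.{0} R))

/-- `R = ℤ`: the tree's integral homology spheres. [folklore] -/
theorem isHomologySphereOver_int_iff (M : Type) [TopologicalSpace M] (n : ℕ) :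
    IsHomologySphereOver ℤ M n ↔ IsHomologySphere M n := Iff.rfl

/-! ## The rung family -/

/-- **RUNG `R` — the `R`-HOMOLOGY-SPHERE SLICE GAP.**  Some model knot `K ⊂ ∂D_k`
(`MMSW.IsModelKnot k K`) is slice in the complement of the dotted handlebody `e(D_k)` inside some
closed connected smooth 4-manifold `M` with the `R`-homology of `S⁴`
(`MMSW.IsSliceDiscInComplement k K M e f`), yet bounds NO smooth proper disc in `ℝ⁴ ∖ D_k`
(`MMSW.IsModelSliceDisc`, the normal form of the crux's no-disc clause,
`Negative.noDisc_iff_forall_not_isModelSliceDisc`).  `R = ℚ`: known (floor); `R = ℤ`: open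
(the rung); `R = ℤ ∧ π₁ = 1`: the crux. [cite: KimWu2018, Def. 1.3] -/
def HomologySphereSliceGap (R : Type) [CommRing R] : Prop :=
  ∃ (k : ℕ) (K : (Metric.sphere (0 : EuclideanSpace ℝ (Fin 2)) 1) → EuclideanSpace ℝ (Fin 4)),
    IsModelKnot k K ∧
    (∃ (M : Type) (_ : TopologicalSpace M) (_ : T2Space M) (_ : SecondCountableTopology M)
        (_ : ChartedSpace (EuclideanSpace ℝ (Fin 4)) M) (_ : IsManifold (𝓡 4) ∞ M),
        CompactSpace M ∧ ConnectedSpace M ∧ IsHomologySphereOver R M 4 ∧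
          ∃ (e : EuclideanSpace ℝ (Fin 4) → M) (f : EuclideanSpace ℝ (Fin 2) → M),
            IsSliceDiscInComplement k K M e f) ∧
    ∀ g, ¬ IsModelSliceDisc k K g

/-- **THE TOP IN LADDER LANGUAGE — the simply connected integral rung.**  As `HomologySphereSliceGap ℤ`
with the positive ambient `M` moreover SIMPLY CONNECTED; by Hurewicz–Whitehead such an `M` is a
homotopy 4-sphere, so this is the crux (`dcrGap_of_simplyConnectedSliceGap`,
`simplyConnectedSliceGap_of_dcrGap`). [cite: HatcherAT2002, Cor. 4.33] -/
def SimplyConnectedSliceGap : Prop :=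
  ∃ (k : ℕ) (K : (Metric.sphere (0 : EuclideanSpace ℝ (Fin 2)) 1) → EuclideanSpace ℝ (Fin 4)),
    IsModelKnot k K ∧
    (∃ (M : Type) (_ : TopologicalSpace M) (_ : T2Space M) (_ : SecondCountableTopology M)
        (_ : ChartedSpace (EuclideanSpace ℝ (Fin 4)) M) (_ : IsManifold (𝓡 4) ∞ M),
        CompactSpace M ∧ SimplyConnectedSpace M ∧ IsHomologySphereOver ℤ M 4 ∧
          ∃ (e : EuclideanSpace ℝ (Fin 4) → M) (f : EuclideanSpace ℝ (Fin 2) → M),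
            IsSliceDiscInComplement k K M e f) ∧
    ∀ g, ¬ IsModelSliceDisc k K g

/-! ## On-path: the crux implies the integral rung -/

/-- **ON-PATH `DcrGap → HomologySphereSliceGap ℤ`.**  A homotopy 4-sphere is compact
(`compactSpace_of_homotopyEquiv_sphere`), simply connected hence connected, and an integral
homology sphere (`SmaleHomologySpheres.isHomologySphere_of_homotopyEquiv_sphere`).
[cite: HatcherAT2002, Prop. 3.29, Cor. 2.11, Cor. 2.14] -/
theorem homologySphereSliceGap_int_of_dcrGap (hX : DcrGap) : HomologySphereSliceGap ℤ := by
  obtain ⟨k, K, hK, ⟨M, _, _, _, _, _, ⟨e⟩, e', f, hd⟩, hN⟩ := Negative.dcrGap_iff_modelForm.1 hX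
  haveI : CompactSpace M := compactSpace_of_homotopyEquiv_sphere (n := 4) (by norm_num) M e
  haveI := Literature.AlgebraicTopology.FundamentalGroup.simplyConnectedSpace_euclideanSphere 4
    (by norm_num)
  haveI : SimplyConnectedSpace M := e.simplyConnectedSpace
  have hH : IsHomologySphere M 4 :=
    SmaleHomologySpheres.isHomologySphere_of_homotopyEquiv_sphere (by norm_num) e
  exact ⟨k, K, hK, ⟨M, _, ‹_›, ‹_›, _, ‹_›, ‹_›, inferInstance,
    (isHomologySphereOver_int_iff M 4).2 hH, e', f, hd⟩, hN⟩

/-- **The crux gives the simply connected rung** (same proof, keeping `π₁ = 1`). [cite: HatcherAT2002, Prop. 3.29] -/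
theorem simplyConnectedSliceGap_of_dcrGap (hX : DcrGap) : SimplyConnectedSliceGap := by
  obtain ⟨k, K, hK, ⟨M, _, _, _, _, _, ⟨e⟩, e', f, hd⟩, hN⟩ := Negative.dcrGap_iff_modelForm.1 hX
  haveI : CompactSpace M := compactSpace_of_homotopyEquiv_sphere (n := 4) (by norm_num) M e
  haveI := Literature.AlgebraicTopology.FundamentalGroup.simplyConnectedSpace_euclideanSphere 4
    (by norm_num)
  haveI : SimplyConnectedSpace M := e.simplyConnectedSpace
  have hH : IsHomologySphere M 4 :=
    SmaleHomologySpheres.isHomologySphere_of_homotopyEquiv_sphere (by norm_num) e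
  exact ⟨k, K, hK, ⟨M, _, ‹_›, ‹_›, _, ‹_›, ‹_›, ‹_›,
    (isHomologySphereOver_int_iff M 4).2 hH, e', f, hd⟩, hN⟩

/-- **RECOGNITION: the simply connected rung IS the crux.**  A closed simply connected smooth
4-manifold with the integral homology of `S⁴` is homotopy equivalent to `S⁴` (Hurewicz +
Whitehead; tree theorem `nonempty_homotopyEquiv_sphere_of_isHomologySphere`), so its datum is a
crux datum. [cite: HatcherAT2002, Cor. 4.33, Cor. A.12] -/
theorem dcrGap_of_simplyConnectedSliceGap (h : SimplyConnectedSliceGap) : DcrGap := by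
  obtain ⟨k, K, hK, ⟨M, _, _, _, _, _, hc, hsc, hH, e', f, hd⟩, hN⟩ := h
  haveI := hc
  haveI := hsc
  obtain ⟨e⟩ := nonempty_homotopyEquiv_sphere_of_isHomologySphere (M := M) (n := 4) (by norm_num)
    ((isHomologySphereOver_int_iff M 4).1 hH)
  exact Negative.dcrGap_iff_modelForm.2 ⟨k, K, hK, ⟨M, _, ‹_›, ‹_›, _, ‹_›, ⟨e⟩, e', f, hd⟩, hN⟩

/-- The simply connected rung implies the integral rung (a simply connected space is connected). [folklore] -/
theorem homologySphereSliceGap_int_of_simplyConnected (h : SimplyConnectedSliceGap) :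
    HomologySphereSliceGap ℤ := by
  obtain ⟨k, K, hK, ⟨M, _, _, _, _, _, hc, hsc, hH, e', f, hd⟩, hN⟩ := h
  haveI := hsc
  exact ⟨k, K, hK, ⟨M, _, ‹_›, ‹_›, _, ‹_›, hc, inferInstance, hH, e', f, hd⟩, hN⟩

/-! ## The floor (`R = ℚ`, `k = 0`): a non-slice knot slice in a punctured rational homology sphere -/

/-- **FLOOR FACT (Kawauchi; Cochran after Fintushel–Stern; Kim–Wu).**  Some knot `K ⊂ S³` that is
NOT smoothly slice bounds a smooth proper disc in `M ∖ e(B̊⁴)` for some closed connected smooth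
4-manifold `M` with the RATIONAL homology of `S⁴` (equivalently: is slice in a rational homology
4-ball `V`, `M = V ∪ B⁴`).  Witness in print: the figure-eight knot `4₁` — rationally (indeed
`ℤ[1/2]`-) slice [Kim–Wu 2018, Def. 1.3 and Lemma 3.1 (2), after Kawauchi 2009; Cochran after
Fintushel–Stern 1984, see Hom–Kang–Park–Stoffregen 2022 §1], and not slice (not even
algebraically slice: Fox–Milnor, `Δ = t² - 3t + 1`) [Kim–Wu 2018, Rem. 1.4].  Hypothesis-shaped
named fact (the tree has no figure-eight knot yet). [cite: KimWu2018, Def. 1.3, Lemma 3.1 (2), Rem. 1.4] [cite: HomKangParkStoffregen2022, §1] -/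
def rationalSliceGap_floor : Prop :=
  ∃ K : Knot, ¬ K.IsSmoothlySlice ∧
    ∃ (M : Type) (_ : TopologicalSpace M) (_ : T2Space M) (_ : SecondCountableTopology M)
      (_ : ChartedSpace (EuclideanSpace ℝ (Fin 4)) M) (_ : IsManifold (𝓡 4) ∞ M),
      CompactSpace M ∧ ConnectedSpace M ∧ IsHomologySphereOver ℚ M 4 ∧
        ∃ (e : EuclideanSpace ℝ (Fin 4) → M) (f : EuclideanSpace ℝ (Fin 2) → M),
          K.IsSliceDiscIn M e f

/-- **WITNESS (F3 / BC5): the floor fact gives RUNG `ℚ` at `k = 0`.**  An H-slice datum for `K`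
in the rational homology sphere `M` is a `k = 0` dotted-slice datum for the rescaled model knot
`L ∘ K ⊂ ∂D_0`, `L = diag(40,40,1,1)` (`Negative.isSliceDiscInComplement_zero_of_isSliceDiscIn`,
`Negative.isModelKnot_scaling_comp`); and a MODEL slice disc for `L ∘ K` in `ℝ⁴ ∖ D_0`, pushed
into `S⁴` by a stereographic chart, un-scaled (`Negative.isSliceDiscIn_of_isSliceDiscInComplement_zero`)
and neatened by Palais (`Knot.palais_ballComplement_sphere_four_holds`,
`Knot.isSmoothlySlice_of_isProperDisc_holds`), would slice `K` in `B⁴`. [cite: Palais1960, Thm. B] -/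
theorem homologySphereSliceGap_rat_of_floor (h : rationalSliceGap_floor) :
    HomologySphereSliceGap ℚ := by
  obtain ⟨L, hL⟩ := Negative.exists_scaling
  have hD := Negative.scaling_mem_modelHandlebody_zero_iff hL
  obtain ⟨K, hKns, M, _, _, _, _, _, hMc, hMconn, hMQ, e, f, hef⟩ := h
  set K' : Metric.sphere (0 : EuclideanSpace ℝ (Fin 2)) 1 → EuclideanSpace ℝ (Fin 4) :=
    (L : EuclideanSpace ℝ (Fin 4) → EuclideanSpace ℝ (Fin 4)) ∘ fun t =>
      ((K t : Metric.sphere (0 : EuclideanSpace ℝ (Fin 4)) 1) : EuclideanSpace ℝ (Fin 4)) with hK'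
  have hmk : IsModelKnot 0 K' := Negative.isModelKnot_scaling_comp hL K
  have hdat : IsSliceDiscInComplement 0 K' M _ f :=
    Negative.isSliceDiscInComplement_zero_of_isSliceDiscIn hD hef
  refine ⟨0, K', hmk, ⟨M, _, ‹_›, ‹_›, _, ‹_›, hMc, hMconn, hMQ, _, f, hdat⟩, fun g hg => hKns ?_⟩
  -- a model slice disc for `K'` in `ℝ⁴ ∖ D_0` would slice `K` in `B⁴`
  have hS := hg.isSliceDiscInComplement_chartAt_symm
    (⟨EuclideanSpace.single 0 1, by simp⟩ : Metric.sphere (0 : EuclideanSpace ℝ (Fin 5)) 1)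
  have hIn := Negative.isSliceDiscIn_of_isSliceDiscInComplement_zero hD hS
  obtain ⟨U, c, hc₁, hc₂⟩ := Knot.palais_ballComplement_sphere_four_holds _ hIn.isSmoothEmbedding
  obtain ⟨g', hg'⟩ := hIn.exists_isProperDisc c hc₁ hc₂
  exact Knot.isSmoothlySlice_of_isProperDisc_holds K g' hg'

/-- **F3 in `example` form**: the rung family specialises to the proved floor. [folklore] -/
example (h : rationalSliceGap_floor) : HomologySphereSliceGap ℚ :=
  homologySphereSliceGap_rat_of_floor h

/-- **RUNG `ℤ` IN CERTIFICATE FORM.**  Some model knot `K ⊂ ∂D_k` with an MMSW certificate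
(`s₋(K) > 0` or `s₊(K) < 0`) is slice in the `D_k`-complement of a closed connected smooth
INTEGRAL HOMOLOGY 4-SPHERE.  At `k = 0` this reads: *some knot with `s ≠ 0` bounds a smooth disc
in a punctured integral homology 4-sphere* — i.e. Rasmussen's `s` is not an invariant of
`ℤ`-homology concordance, open [Hom–Kang–Park–Stoffregen 2022, §1; Ray 2024, p. 17].  No `π₁ = 1`,
no homotopy sphere: the ambient supply (spun / twist-spun homology 3-spheres, boundaries of
thickened acyclic 2-complexes) is unconditional and enumerable by Kirby diagrams.
[cite: HomKangParkStoffregen2022, §1] [cite: ManolescuMarengonSarkarWillis2023, Def. 8.1, Question 9.11] -/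
def CertificateBeyondHomology : Prop :=
  ∃ (k : ℕ) (K : (Metric.sphere (0 : EuclideanSpace ℝ (Fin 2)) 1) → EuclideanSpace ℝ (Fin 4)),
    (∃ (M : Type) (_ : TopologicalSpace M) (_ : T2Space M) (_ : SecondCountableTopology M)
        (_ : ChartedSpace (EuclideanSpace ℝ (Fin 4)) M) (_ : IsManifold (𝓡 4) ∞ M),
        CompactSpace M ∧ ConnectedSpace M ∧ IsHomologySphereOver ℤ M 4 ∧
          ∃ (e : EuclideanSpace ℝ (Fin 4) → M) (f : EuclideanSpace ℝ (Fin 2) → M),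
            IsSliceDiscInComplement k K M e f) ∧
    ∃ w : MMSWRasmussen k K, 0 < w.sMinus ∨ w.sPlus < 0

/-- **The certificate closes the rung, given MMSW Lemma 8.19**: a model slice disc would force
`s₋ ≤ 0 ≤ s₊` (`MMSWRasmussen.sMinus_nonpos_sPlus_nonneg`). [cite: ManolescuMarengonSarkarWillis2023, Lemma 8.19] -/
theorem homologySphereSliceGap_int_of_certificate (hc : CertificateBeyondHomology)
    (h19 : MMSW.sMinus_nonpos_of_isModelSliceDisc) : HomologySphereSliceGap ℤ := by
  obtain ⟨k, K, hdat, w, hw⟩ := hc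
  refine ⟨k, K, w.isModelKnot, hdat, fun g hg => ?_⟩
  have h := w.sMinus_nonpos_sPlus_nonneg h19 hg
  omega

/-- The skeleton's composition with the three stub STATEMENTS of `Lines/homology_ladder.lean` as explicit
hypotheses (sorry-free): certificate + MMSW L8.19 ⇒ Rung `ℤ`; passage ⇒ simply connected rung; recognition ⇒ crux. [folklore] -/
theorem dcrGap_of_parts (hc : CertificateBeyondHomology) (h19 : MMSW.sMinus_nonpos_of_isModelSliceDisc)
    (hup : HomologySphereSliceGap ℤ → SimplyConnectedSliceGap) : DcrGap :=
  dcrGap_of_simplyConnectedSliceGap (hup (homologySphereSliceGap_int_of_certificate hc h19))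

end Summit.SmoothPoincare4.SmoothPoincare4.Cruxes.DcrGap.HomologyLadder.Special

end
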